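import Mathlib
import Literature.MathematicalPhysics.QuantumFieldTheory.Balaban1983to89.B4TorusPositivity
import Literature.MathematicalPhysics.QuantumFieldTheory.Balaban1983to89.B5QGGQ145Factor
import Literature.MathematicalPhysics.QuantumFieldTheory.Balaban1983to89.B5Blocks16
import Summits.QuantumFields.BalabanUV.T4Continuum.Support.SliceFlatGaugeGreen

/-!
# T⁴ programme, node NE3 — BRIDGE-126, part 2a: the carrier dictionary `Tor (fine n N) ↔ ℤ^{d+1} ∕ Idx (n·N)` between
# pv15's MATRICES and b04's periodic-function STENCIL, and the identification `G′Q′* = K_T` of the concrete Green column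
# with b04's torus kernel (hence with b05's `KRe`)

Fourteenth generation of the NE3 prover lineage P1 of the cell `pub-balaban`, file 3.  Part 1 (`SliceFlatGaugeProjection`,
`SliceFlatGaugeGreen`) wrote pv15's `∂P∂*` as `Re ∂ · [G′Q′ᵀ(Q′G′²Q′ᵀ)⁻¹Q′G′] · (Re ∂)ᵀ` with CONCRETE real matrix inverses
on `Tor (fine n N)`.  THIS FILE identifies the first factor with b04∕b05's kernel objects:
 * §1 carriers: `castT z = (z_i mod nN_i)_i`, `repT x = (val x_i)_i`, the bijections **`idxT : Tor (fine n N) ≃ Idx (n·N)`**,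
   `idxB : Tor N ≃ Idx N` (`toZ ∘ idxT = repT`), `castT` of translates∕sums∕unit vectors, **`castT_finePt`** (b04's fine point
   `n·y + j` IS pv15's block point `bpt (castB y) j`, [B5] (1.6)), `blockOf_castT`;
 * §2 the STENCIL DICTIONARY: for `f : Tor (fine n N) → ℂ` and its periodic lift `liftT f = f ∘ castT` (`liftT_periodic`):
   `QsOp_apply_eq` (`Q′(y,x) = n^{−D}·𝟙[x ∈ B(y)]`), **`blockAvg_liftT`** (b04's `Q^*Q` of B4 (1.4)–(1.5) IS pv15's
   `n^D·Q′ᴴQ′`), **`negLap_liftT`** (b04's `−Δ^ξ` IS pv15's `LapS` at `c = n`), **`opD_liftT`**: `(−Δ^ξ + 0 + aQ^*Q)(f ∘ castT)(z)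
   = ((Δ_n + a·n^D·Q′ᴴQ′) f)(castT z)` — b04's `B4Green244.opD n a 0` IS the matrix `Km (a·n^D) n` of part 1b, complexified;
 * §3 **`Gm_QsW_eq_KRe`**: for `a > 0` the column `y` of `Gm (a·n^D) n · (n^D·(Re Q′)ᵀ)` (= `G′Q′*δ_y` with the PRINTED adjoint
   `Q′* = n^D Q′ᵀ`, [B5] p. 22) lifts to a periodic solution of `D ψ = 𝟙[⌊·/n⌋ ≡ y]` (`torusGreen244`'s right side), hence by
   b04's **`B4TorusPositivity.torusGreen244_unique`** IS `K_T(·, y)`: `(Gm·Q′*)(x,y) = KRe n a N (idxT x) (idxB y)` = b05's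
   `B5QGGQ145Factor.KRe` — the matrix of `G′Q′*` in BOTH chains is one object.
WHAT THIS BUYS (honest): the first of the three factor identifications of BRIDGE-126 (cell census G-B5-35 (iii): «the carrier
dictionary … NOT typed»); the remaining two (`Q′G′²Q′*` ↔ `qggqRe`, `(·)⁻¹ ↔ `kerRe`, `Q′G′` ↔ `QGRe`; `Re ∂_n` ↔ `Dmat`) and the
uptake of `B5DPD126Uniform.matrixP_decay_uniform` as the (3.49) gauge half at `U = 1` are part 2b.  Nothing here is an
estimate; NE3 is NOT proved.

Honest framing: finite-T⁴ ultraviolet bookkeeping about MINIMISERS (rung (B)+1 of the cell's ladder); no conditional of the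
cell (`BetaPertH`, (B), (B^μ)) is used or hidden; nothing bears on infinite volume, a mass gap, or the Clay problem.  ABSOLUTE
RULE of the cell kept: inputs are kernel-proved tree modules only (b04 `B4Green244`∕`B4TorusGreen244`∕`B4TorusPositivity`, b05
`B5QGGQ145Factor`, pv15 `B5Block118`∕`B5Blocks16`∕`B5RealFields`, this lineage's part 1); `[B5]`∕`[B4]` pointers locate
DEFINITIONS only.  No `sorry`, no axioms beyond Mathlib's.  PLACEMENT (human rule 2026-08-19): cell work under
`Summits/QuantumFields/BalabanUV/`; moves nothing.  Records: `t4/T4-EST-U1b-OSC.md` v1.29 (RESULT 37), `t4/T4-EST-NE3-P1.md`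
v2.28, GAPS G-ne3p1-43 of the cell `pub-balaban`.
-/

noncomputable section

open scoped Matrix ComplexConjugate
open Finset Matrix

namespace Summit.QuantumFields.BalabanUV.T4Continuum.SliceFlatGaugeKernel

open Literature.MathematicalPhysics.QuantumFieldTheory.Balaban1983to89
open Literature.MathematicalPhysics.QuantumFieldTheory.Balaban1983to89.B5Prop11Plancherel (Tor fine unitVec)
open Literature.MathematicalPhysics.QuantumFieldTheory.Balaban1983to89.B5Action121 (LapS LapS_mulVec)
open Literature.MathematicalPhysics.QuantumFieldTheory.Balaban1983to89.B5Block118 (QsOp QsOp_mulVec bpt up iota upHom_intCast)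
open Literature.MathematicalPhysics.QuantumFieldTheory.Balaban1983to89.B5Blocks16 (blockOf blockOf_bpt bpt_bijective)
open Literature.MathematicalPhysics.QuantumFieldTheory.Balaban1983to89.B5RealFields
  (reM cplx IsReal cplx_apply reM_conjTranspose reM_add reM_smul_ofReal isReal_LapS isReal_QsOp)
open Literature.MathematicalPhysics.QuantumFieldTheory.Balaban1983to89.B4Green244 (coarse offset finePt e negLap blockAvg opD
  finePt_coarse_offset)
open Literature.MathematicalPhysics.QuantumFieldTheory.Balaban1983to89.B4TorusGreen244 (KT)
open Literature.MathematicalPhysics.QuantumFieldTheory.Balaban1983to89.B4TorusPositivity (IsPeriodic torusGreen244_unique)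
open Literature.MathematicalPhysics.QuantumFieldTheory.Balaban1983to89.B5QGGQ145Bounds (Idx toZ)
open Literature.MathematicalPhysics.QuantumFieldTheory.Balaban1983to89.B5QGGQ145Factor (KRe)
open Summit.QuantumFields.BalabanUV.T4Continuum.SliceFlatGaugeProjection (conj_ofReal')
open Summit.QuantumFields.BalabanUV.T4Continuum.SliceFlatGaugeGreen

variable {d : ℕ} (n : ℕ) [NeZero n] (N : Fin (d + 1) → ℕ) [hN : ∀ i, NeZero (N i)]

/-! ## §1  Carriers: integer representatives, casts, the index bijections -/
section Carriers

/-- Cast of an integer point of `ℤ^{d+1}` to pv15's fine torus `Π_i ℤ/(nN_i)`. [folklore] -/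
def castT (z : Fin (d + 1) → ℤ) : Tor (fine n N) := fun i => (z i : ZMod (fine n N i))

omit [NeZero n] hN in
/-- Cast of an integer point to the block torus `Π_i ℤ/N_i`. [folklore] -/
def castB (y : Fin (d + 1) → ℤ) : Tor N := fun i => (y i : ZMod (N i))

/-- The integer representative `(val x_i)_i ∈ Π_i [0, nN_i)` of a fine torus point. [folklore] -/
def repT (x : Tor (fine n N)) : Fin (d + 1) → ℤ := fun i => ((x i).val : ℤ)

omit [NeZero n] in
/-- The integer representative of a block torus point. [folklore] -/
def repB (y : Tor N) : Fin (d + 1) → ℤ := fun i => ((y i).val : ℤ)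

/-- `castT ∘ repT = id`. [folklore] -/
theorem castT_repT (x : Tor (fine n N)) : castT n N (repT n N x) = x := by
  funext i; simp [castT, repT]

omit [NeZero n] in
/-- `castB ∘ repB = id`. [folklore] -/
theorem castB_repB (y : Tor N) : castB N (repB N y) = y := by
  funext i; simp [castB, repB]

omit [NeZero n] hN in
/-- The cast is additive. [folklore] -/
theorem castT_add (z w : Fin (d + 1) → ℤ) : castT n N (z + w) = castT n N z + castT n N w := by
  funext i; simp [castT]

omit [NeZero n] hN in
/-- The cast is subtractive. [folklore] -/
theorem castT_sub (z w : Fin (d + 1) → ℤ) : castT n N (z - w) = castT n N z - castT n N w := by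
  funext i; simp [castT]

omit [NeZero n] hN in
/-- The cast of b04's unit vector `e_μ` is pv15's `unitVec μ`. [folklore] -/
theorem castT_e (μ : Fin (d + 1)) : castT n N (e μ) = unitVec (fine n N) μ := by
  funext i
  by_cases h : i = μ
  · subst h; simp [castT, e, unitVec]
  · simp [castT, e, unitVec, Pi.single_eq_of_ne h]

omit [NeZero n] hN in
/-- The cast forgets period translates. [folklore] -/
theorem castT_translate (z m : Fin (d + 1) → ℤ) :
    castT n N (B4TorusKernel.MultiPeriod.translate (fun i => n * N i) z m) = castT n N z := by
  funext i
  simp only [castT, B4TorusKernel.MultiPeriod.translate_apply, Int.cast_add, Int.cast_mul, Int.cast_natCast]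
  rw [show ((n * N i : ℕ) : ZMod (fine n N i)) = 0 from ZMod.natCast_self (n * N i), zero_mul, add_zero]

/-- **The index bijection `Tor (fine n N) ≃ Idx (n·N)`** (values ↔ `Fin`). [folklore] -/
def idxT : Tor (fine n N) ≃ Idx (fun i => n * N i) where
  toFun x i := ⟨(x i).val, ZMod.val_lt (x i)⟩
  invFun k i := ((k i : ℕ) : ZMod (fine n N i))
  left_inv x := funext fun i => by simp
  right_inv k := funext fun i => Fin.ext (by simp [ZMod.val_natCast, Nat.mod_eq_of_lt (k i).isLt])

omit [NeZero n] in
/-- The index bijection `Tor N ≃ Idx N`. [folklore] -/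
def idxB : Tor N ≃ Idx N where
  toFun y i := ⟨(y i).val, ZMod.val_lt (y i)⟩
  invFun k i := ((k i : ℕ) : ZMod (N i))
  left_inv y := funext fun i => by simp
  right_inv k := funext fun i => Fin.ext (by simp [ZMod.val_natCast, Nat.mod_eq_of_lt (k i).isLt])

/-- `toZ ∘ idxT = repT`. [folklore] -/
theorem toZ_idxT (x : Tor (fine n N)) : toZ (idxT n N x) = repT n N x := rfl

omit [NeZero n] in
/-- `toZ ∘ idxB = repB`. [folklore] -/
theorem toZ_idxB (y : Tor N) : toZ (idxB N y) = repB N y := rfl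

omit [NeZero n] hN in
/-- **b04's fine point `n·y + j` IS pv15's block point `bpt (castB y) j`** ([B5] (1.6) ∕ B4 (1.4): the same blocks). [folklore] -/
theorem castT_finePt (y : Fin (d + 1) → ℤ) (j : Fin (d + 1) → Fin n) :
    castT n N (finePt n y j) = bpt n N (castB N y) j := by
  funext ν
  show ((((n : ℤ) * y ν + ((j ν : ℕ) : ℤ) : ℤ)) : ZMod (fine n N ν)) = up n N (castB N y) ν + iota n N j ν
  have hup : up n N (castB N y) ν = (n : ZMod (fine n N ν)) * ((y ν : ℤ) : ZMod (fine n N ν)) :=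
    upHom_intCast n N ν (y ν)
  rw [hup, iota]
  push_cast
  ring

omit hN in
/-- `castT z = bpt (castB ⌊z/n⌋) (z mod n)`. [folklore] -/
theorem castT_eq_bpt (z : Fin (d + 1) → ℤ) : castT n N z = bpt n N (castB N (coarse n z)) (offset n z) := by
  rw [← castT_finePt, finePt_coarse_offset]

/-- **The block of `castT z` is `castB ⌊z/n⌋`.** [folklore] -/
theorem blockOf_castT (z : Fin (d + 1) → ℤ) : blockOf n N (castT n N z) = castB N (coarse n z) := by
  rw [castT_eq_bpt, blockOf_bpt]

omit [NeZero n] hN in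
/-- `castB w = castB w′ ↔ N_i ∣ w_i − w′_i` for all `i`. [folklore] -/
theorem castB_eq_castB_iff (w w' : Fin (d + 1) → ℤ) : castB N w = castB N w' ↔ ∀ i, (N i : ℤ) ∣ w i - w' i := by
  constructor
  · intro h i
    have hi := congrFun h i
    simp only [castB] at hi
    exact (ZMod.intCast_eq_intCast_iff_dvd_sub (w' i) (w i) (N i)).mp hi.symm
  · intro h
    funext i
    exact ((ZMod.intCast_eq_intCast_iff_dvd_sub (w' i) (w i) (N i)).mpr (h i)).symm

end Carriers

/-! ## §2  The stencil dictionary: b04's `opD n a 0` on periodic lifts IS pv15's `LapS + a·n^D·Q′ᴴQ′` -/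
section Stencil

/-- The periodic lift of a function on the fine torus to `ℤ^{d+1}`. [folklore] -/
def liftT (f : Tor (fine n N) → ℂ) : (Fin (d + 1) → ℤ) → ℂ := fun z => f (castT n N z)

omit [NeZero n] hN in
/-- The lift is `(nN_i)_i`-periodic. [folklore] -/
theorem liftT_periodic (f : Tor (fine n N) → ℂ) : IsPeriodic (fun i => n * N i) (liftT n N f) := fun z m => by
  simp only [liftT, castT_translate]

/-- The lift read back on representatives. [folklore] -/
theorem liftT_repT (f : Tor (fine n N) → ℂ) (x : Tor (fine n N)) : liftT n N f (repT n N x) = f x := by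
  rw [liftT, castT_repT]

/-- **Entries of `Q′`**: `Q′(y, x) = n^{−D}·𝟙[x ∈ B(y)]`, `B(y)` = the block of `y` ([B5] (1.6)∕(1.20); the blocks partition
the fine torus, `B5Blocks16.bpt_bijective`). [folklore] -/
theorem QsOp_apply_eq (y : Tor N) (x : Tor (fine n N)) :
    QsOp n N y x = if blockOf n N x = y then 1 / (n : ℂ) ^ (d + 1) else 0 := by
  classical
  set E := Equiv.ofBijective _ (bpt_bijective n N) with hE
  obtain ⟨⟨y₀, j₀⟩, rfl⟩ : ∃ p : Tor N × (Fin (d + 1) → Fin n), E p = x := E.surjective x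
  have hEapp : E (y₀, j₀) = bpt n N y₀ j₀ := rfl
  have hblk : blockOf n N (E (y₀, j₀)) = y₀ := by rw [hEapp, blockOf_bpt]
  rw [hblk, QsOp, hEapp]
  have hiff : ∀ j, (bpt n N y₀ j₀ = bpt n N y j) ↔ (y₀ = y ∧ j₀ = j) := by
    intro j
    constructor
    · intro h
      have := bpt_bijective n N |>.1 (a₁ := (y₀, j₀)) (a₂ := (y, j)) h
      exact ⟨congrArg Prod.fst this, congrArg Prod.snd this⟩
    · rintro ⟨rfl, rfl⟩; rfl
  simp_rw [hiff]
  by_cases hy : y₀ = y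
  · subst hy
    simp
  · simp [hy]

/-- `(Q′ᴴQ′ f)(x) = n^{−2D} Σ_j f(bpt (blockOf x) j)`. [folklore] -/
theorem QsOpH_QsOp_mulVec (f : Tor (fine n N) → ℂ) (x : Tor (fine n N)) :
    (((QsOp n N)ᴴ * QsOp n N) *ᵥ f) x
      = (1 / (n : ℂ) ^ (d + 1)) * ((1 / (n : ℂ) ^ (d + 1)) * ∑ j : Fin (d + 1) → Fin n, f (bpt n N (blockOf n N x) j)) := by
  classical
  rw [← Matrix.mulVec_mulVec, Matrix.mulVec, dotProduct]
  have hterm : ∀ y, (QsOp n N)ᴴ x y * (QsOp n N *ᵥ f) y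
      = if blockOf n N x = y then (1 / (n : ℂ) ^ (d + 1)) * (QsOp n N *ᵥ f) y else 0 := by
    intro y
    rw [Matrix.conjTranspose_apply, QsOp_apply_eq]
    split_ifs with h
    · rw [Complex.star_def, map_div₀, map_one, map_pow, Complex.conj_natCast]
    · rw [star_zero, zero_mul]
  simp_rw [hterm]
  rw [Finset.sum_ite_eq, if_pos (Finset.mem_univ _), QsOp_mulVec]

/-- **b04's block-averaging projection IS pv15's `n^D·Q′ᴴQ′`** on lifts: `(Q^*Q (f ∘ castT))(z) = ((n^D·Q′ᴴQ′) f)(castT z)`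
(B4 (1.4)–(1.5) ↔ [B5] (1.18)∕(1.20)). [folklore] -/
theorem blockAvg_liftT (f : Tor (fine n N) → ℂ) (z : Fin (d + 1) → ℤ) :
    blockAvg n (liftT n N f) z = ((((n : ℂ) ^ (d + 1)) • ((QsOp n N)ᴴ * QsOp n N)) *ᵥ f) (castT n N z) := by
  have hn : ((n : ℂ) ^ (d + 1)) ≠ 0 := pow_ne_zero _ (by exact_mod_cast NeZero.ne n)
  rw [Matrix.smul_mulVec, Pi.smul_apply, QsOpH_QsOp_mulVec, blockOf_castT, smul_eq_mul, blockAvg]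
  simp only [liftT, castT_finePt]
  field_simp

/-- **b04's `−Δ^ξ` IS pv15's scalar Laplacian at lattice parameter `c = n`** on lifts. [folklore] -/
theorem negLap_liftT (f : Tor (fine n N) → ℂ) (z : Fin (d + 1) → ℤ) :
    negLap n (liftT n N f) z = (LapS (fine n N) (n : ℂ) *ᵥ f) (castT n N z) := by
  rw [LapS_mulVec, negLap, Finset.mul_sum]
  refine Finset.sum_congr rfl fun μ _ => ?_
  simp only [liftT, castT_add, castT_sub, castT_e, Complex.conj_natCast]
  ring

/-- **THE STENCIL DICTIONARY**: b04's `D = −Δ^ξ + 0 + aQ^*Q` (`B4Green244.opD n a 0`) applied to the periodic lift of `f` is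
pv15's matrix `Δ_n + a·n^D·Q′ᴴQ′` applied to `f`, read at `castT z`. [folklore] -/
theorem opD_liftT (a : ℝ) (f : Tor (fine n N) → ℂ) (z : Fin (d + 1) → ℤ) :
    opD n a 0 (liftT n N f) z
      = ((LapS (fine n N) (n : ℂ) + (a : ℂ) • (((n : ℂ) ^ (d + 1)) • ((QsOp n N)ᴴ * QsOp n N))) *ᵥ f) (castT n N z) := by
  rw [opD, negLap_liftT, blockAvg_liftT, Complex.ofReal_zero, zero_mul, add_zero]
  simp only [Matrix.add_mulVec, Pi.add_apply, Matrix.smul_mulVec, Pi.smul_apply, smul_eq_mul]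

end Stencil

/-! ## §3  The concrete Green column is b04's torus kernel: `G′Q′* = K_T = KRe` -/
section Kernel

/-- The complexified matrix of §2 has real part part 1b's `Km (a·n^D) n`. [folklore] -/
theorem reM_opMatrix (a : ℝ) :
    reM (LapS (fine n N) (n : ℂ) + (a : ℂ) • (((n : ℂ) ^ (d + 1)) • ((QsOp n N)ᴴ * QsOp n N)))
      = Km n N (a * (n : ℝ) ^ (d + 1)) (n : ℝ) := by
  rw [Km, reM_add, smul_smul, show ((a : ℂ) * (n : ℂ) ^ (d + 1)) = ((a * (n : ℝ) ^ (d + 1) : ℝ) : ℂ) by push_cast; ring,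
    reM_smul_ofReal, (isReal_QsOp n N).conjTranspose.reM_mul (isReal_QsOp n N), reM_conjTranspose, Complex.ofReal_natCast]

/-- The complexified matrix of §2 is real. [folklore] -/
theorem isReal_opMatrix (a : ℝ) :
    IsReal (LapS (fine n N) (n : ℂ) + (a : ℂ) • (((n : ℂ) ^ (d + 1)) • ((QsOp n N)ᴴ * QsOp n N))) := by
  refine (isReal_LapS (fine n N) (Complex.conj_natCast n)).add (IsReal.smul (Complex.conj_ofReal a) ?_)
  exact IsReal.smul (by rw [map_pow, Complex.conj_natCast]) ((isReal_QsOp n N).conjTranspose.mul (isReal_QsOp n N))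

/-- **The PRINTED adjoint `Q′* = n^D·Q′ᵀ`** (block-constant extension, [B5] p. 22; b05-g13's `QsW`) as a real matrix. [model] -/
def QsWm : Matrix (Tor (fine n N)) (Tor N) ℝ := ((n : ℝ) ^ (d + 1)) • (reM (QsOp n N))ᵀ

/-- Entries of `Q′*`: `𝟙[x ∈ B(y)]`. [folklore] -/
theorem QsWm_apply (x : Tor (fine n N)) (y : Tor N) : QsWm n N x y = if blockOf n N x = y then 1 else 0 := by
  have hn : ((n : ℝ) ^ (d + 1)) ≠ 0 := pow_ne_zero _ (by exact_mod_cast NeZero.ne n)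
  rw [QsWm, Matrix.smul_apply, Matrix.transpose_apply, smul_eq_mul]
  have h : reM (QsOp n N) y x = if blockOf n N x = y then 1 / (n : ℝ) ^ (d + 1) else 0 := by
    show (QsOp n N y x).re = _
    rw [QsOp_apply_eq]
    split_ifs
    · rw [show (1 / (n : ℂ) ^ (d + 1)) = ((1 / (n : ℝ) ^ (d + 1) : ℝ) : ℂ) by push_cast; rfl, Complex.ofReal_re]
    · simp
  rw [h]
  split_ifs
  · field_simp
  · rw [mul_zero]

/-- **The concrete Green column**: `col y := (G′·Q′*)(·, y)` with `G′ = Gm (a·n^D) n` of part 1b. [model] -/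
def greenCol (a : ℝ) (y : Tor N) : Tor (fine n N) → ℝ := fun x => (Gm n N (a * (n : ℝ) ^ (d + 1)) (n : ℝ) * QsWm n N) x y

/-- `K · col y = Q′*δ_y = 𝟙[· ∈ B(y)]` (`K·G′ = 1`). [folklore] -/
theorem Km_mulVec_greenCol {a : ℝ} (ha : 0 < a) (y : Tor N) (x : Tor (fine n N)) :
    (Km n N (a * (n : ℝ) ^ (d + 1)) (n : ℝ) *ᵥ greenCol n N a y) x = if blockOf n N x = y then 1 else 0 := by
  have hn0 : (n : ℝ) ≠ 0 := by exact_mod_cast NeZero.ne n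
  have haK : 0 < a * (n : ℝ) ^ (d + 1) := mul_pos ha (by positivity)
  have hcol : greenCol n N a y = fun x => (Gm n N (a * (n : ℝ) ^ (d + 1)) (n : ℝ) * QsWm n N) x y := rfl
  have h : (Km n N (a * (n : ℝ) ^ (d + 1)) (n : ℝ) *ᵥ greenCol n N a y) x
      = (Km n N (a * (n : ℝ) ^ (d + 1)) (n : ℝ) * (Gm n N (a * (n : ℝ) ^ (d + 1)) (n : ℝ) * QsWm n N)) x y := by
    simp only [hcol, Matrix.mulVec, dotProduct, Matrix.mul_apply]
  rw [h, ← Matrix.mul_assoc, Km_mul_Gm n N hn0 haK, Matrix.one_mul, QsWm_apply]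

/-- `x ∈ B(y)` read through b04's block label: `blockOf (castT z) = y ↔ N_i ∣ ⌊z/n⌋_i − (repB y)_i`. [folklore] -/
theorem blockOf_castT_eq_iff (z : Fin (d + 1) → ℤ) (y : Tor N) :
    blockOf n N (castT n N z) = y ↔ ∀ i, (N i : ℤ) ∣ coarse n z i - repB N y i := by
  rw [blockOf_castT, ← castB_eq_castB_iff, castB_repB]

/-- **`G′Q′* = K_T`: THE CONCRETE GREEN COLUMN IS b04's TORUS KERNEL.**  For `a > 0`, every block point `y` and fine point
`x`: `(Gm (a·n^D) n · Q′*)(x, y) = Re K_T(repT x, repB y) = KRe n a N (idxT x) (idxB y)` — the periodic lift of the column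
solves `D ψ = 𝟙[⌊·/n⌋ ≡ y mod N]` (`opD_liftT`, `Km_mulVec_greenCol`), so `B4TorusPositivity.torusGreen244_unique` applies.
[folklore] -/
theorem Gm_QsW_eq_KRe {a : ℝ} (ha : 0 < a) (x : Tor (fine n N)) (y : Tor N) :
    (Gm n N (a * (n : ℝ) ^ (d + 1)) (n : ℝ) * QsWm n N) x y = KRe n a N (idxT n N x) (idxB N y) := by
  have hn1 : 1 ≤ n := Nat.one_le_iff_ne_zero.mpr (NeZero.ne n)
  have hN1 : ∀ i, 1 ≤ N i := fun i => Nat.one_le_iff_ne_zero.mpr (NeZero.ne (N i))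
  -- the lifted complexified column solves b04's basic equation
  set ψ : (Fin (d + 1) → ℤ) → ℂ := liftT n N (cplx (greenCol n N a y)) with hψ
  have hD : ∀ z, opD n a 0 ψ z = if ∀ i, (N i : ℤ) ∣ coarse n z i - repB N y i then 1 else 0 := by
    intro z
    rw [hψ, opD_liftT, ← (isReal_opMatrix n N a).cplx_mulVec, reM_opMatrix, cplx_apply, Km_mulVec_greenCol n N ha]
    by_cases h : blockOf n N (castT n N z) = y
    · rw [if_pos h, if_pos ((blockOf_castT_eq_iff n N z y).mp h), Complex.ofReal_one]
    · rw [if_neg h, if_neg (fun h' => h ((blockOf_castT_eq_iff n N z y).mpr h')), Complex.ofReal_zero]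
  have huniq := torusGreen244_unique n hn1 a 0 ha le_rfl hN1 (repB N y) ψ (liftT_periodic n N _) hD
  have hx := congrFun huniq (repT n N x)
  rw [hψ, liftT_repT, cplx_apply] at hx
  show greenCol n N a y x = KRe n a N (idxT n N x) (idxB N y)
  rw [KRe, Matrix.of_apply, toZ_idxT, toZ_idxB, ← hx, Complex.ofReal_re]

end Kernel

end Summit.QuantumFields.BalabanUV.T4Continuum.SliceFlatGaugeKernel
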